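import Summits.BirchSwinnertonDyer.BirchSwinnertonDyer.Theorems.KolyvaginDepthDoorDepthTableLambdaRowPredictionSpade
import HarnessLib

/-!
# Route `KolyvaginDepthDoor` — row-specific λ-predictions COMPOSED, rows 2/3: `664a1, 681c1, 707a1, 709a1, 718b1, 794a1`
# (crux `KolyvaginDepthSupply`, stmt-BirchSwinnertonDyer-21765)

Helper file (`--supports stmt-BirchSwinnertonDyer-21765 --as helper`); it closes nothing and BSD is
not proved by it. Per-curve compositions of `KolyvaginDepthDoorDepthTableLambdaRowPrediction(Spade)`
(module docstrings there) at the depth table's OWN field: for each row `(E, p, d_K)` of g2's table, the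
`p`-adic atlas cell at `p` (kernel-checked `ord_T L_p = 2`, hence `rank = 2 = s_p`, `t_p = 0`, modulo
`hPRS`, Kato 17.4 `hkato` and the symbol DATA), `ρ̄_{E,p}` onto, the Heegner hypothesis, `2 ≤ rank` and
W. Zhang's ♠ (all kernel theorems of the tree), and the ONE twist datum `s_p(E^{(d_K)}) ≤ 1`
(= `r_an(E^{(d_K)}) ≤ 1` through GZK; the table's field-selection criterion; a HYPOTHESIS) give, FOR
THIS `K`, a Kolyvagin PRIME `ℓ`, a level `M ≤ M(ℓ)` and a Kolyvagin–Heegner datum with `c_M(ℓ) ≠ 0` —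
the depth table's bit PREDICTED at the row's field from the cyclotomic side. Inert-`p` rows go through
W. Zhang 2014 Thm. 1.1 (`hZ`; then also: no non-zero class at depth `0`, `rank E^K < rank E`), the
odd split-`p` rows of the curves additive at `2` through BCGS 2026 Thm. 1 (`hA`). Pattern and showcase:
`C389a1.exists_kolyvaginPrime_class_ne_zero_of_lambda_at`. CONDITIONAL as stated; BSD is not proved by it.

References: [WZhang2014] Thm. 1.1 (p. 195); [BurungaleEtAl2026] Thm. 1; [Kolyvagin1991MathAnn] §2 Thm. 4;
[SteinWuthrich2013] Thm. 1.1, §3; [CremonaAlgorithms1997] Table 1.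
-/

set_option linter.dupNamespace false

noncomputable section

open scoped Classical NumberField

namespace Summit.BirchSwinnertonDyer.BirchSwinnertonDyer.Theorems.KolyvaginDepthDoor

open Literature.NumberTheory.EllipticCurves Literature.NumberTheory.EllipticCurves.ModularForms
  WeierstrassCurve CongruenceSubgroup
open Summit.BirchSwinnertonDyer.BirchSwinnertonDyer.Theorems
open Summit.BirchSwinnertonDyer.BirchSwinnertonDyer.Rank2Observatory
open Summit.BirchSwinnertonDyer.BirchSwinnertonDyer.Rank1Residual

namespace C664a1

/-- **ROW `664a1`, `(p, d_K) = (5, −39)` (g2's `depthRow_5_neg39_29`; `5` split in `K`) — row-specific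
λ-prediction via BCGS 2026 Thm. 1 (`hA`; `d_K` odd, `5` split).** For the cell `c ∈ c664a1.cells` with `c.p = 5` and any `K` with
`d_K = −39`: the twist datum `s_5(E^{(−39)}) ≤ 1`, `hF`, `hPRS`, the newform, Kato 17.4 and the symbol
DATA give a Kolyvagin PRIME `ℓ` for `(E, K, 5)`, `M ≤ M(ℓ)` and a datum with `c_M(ℓ) ≠ 0`
(side conditions kernel theorems). CONDITIONAL as stated; per-curve; BSD is not proved by it.
[cite: BurungaleEtAl2026, Thm. 1 (arXiv:2312.09301 §0.1)] [cite: Kolyvagin1991MathAnn, §2 Thm. 4] -/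
theorem exists_kolyvaginPrime_class_ne_zero_of_lambda_at
    (hA : BurungaleEtAl2026_exists_kolyvaginClass_ne_zero)
    (hF : Kolyvagin1991_selmerCorank_of_kolyvaginClass_ne_zero) (hPRS : Schneider1985_order_charGenerator)
    (K : Type) [Field K] [NumberField K] (hK : IsImaginaryQuadratic K) (hD : NumberField.discr K = -39)
    {c : AtlasCell} (hc : c ∈ c664a1.cells) (hc5 : c.p = 5) :
    haveI := isElliptic_c664a1;
    haveI := isGloballyMinimal_c664a1;
    haveI : NeZero (((⟨0, 0, 0, -7, 10⟩ : WeierstrassCurve ℤ).map (Int.castRingHom ℚ)).conductorNorm ℤ) := neZero_conductorNorm_of_isElliptic _;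
    (((⟨0, 0, 0, -7, 10⟩ : WeierstrassCurve ℤ).map (Int.castRingHom ℚ)).quadraticTwist ((-39 : ℤ) : ℚ)).selmerCorank 5 ≤ 1 →
    ∀ {N : ℕ} [NeZero N] {f : CuspForm (Gamma0 N) 2}
    (_hf : IsNewformOf ((⟨0, 0, 0, -7, 10⟩ : WeierstrassCurve ℤ).map (Int.castRingHom ℚ)) f)
    (_hkato : ∀ (κ : ZpExtension ℚ 5) (γ : Field.absoluteGaloisGroup ℚ),
      kato_divisibility ((⟨0, 0, 0, -7, 10⟩ : WeierstrassCurve ℤ).map (Int.castRingHom ℚ)) 5 (κ := κ) (γ := γ) (f := f))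
    (D : ℚ) (_hD : ‖(D : ℚ_[5])‖ = 1) (_hint : ∀ x : ℚ, ‖(ratPlusSymbol f x : ℚ_[5])‖ ≤ 1)
    (_htab : ∀ u : ℕ, u < 5 ^ (c.n + 1) → ¬ 5 ∣ u →
      ratPlusSymbol f ((u : ℚ) / (5 : ℚ) ^ (c.n + 1)) = (c.tabHi.getD u 0 : ℚ) / D ∧
      ratPlusSymbol f ((u : ℚ) / (5 : ℚ) ^ c.n) = (c.tabLo.getD (u % 5 ^ c.n) 0 : ℚ) / D),
    ∃ (Dt : ModularParametrizationData ((⟨0, 0, 0, -7, 10⟩ : WeierstrassCurve ℤ).map (Int.castRingHom ℚ))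
        (((⟨0, 0, 0, -7, 10⟩ : WeierstrassCurve ℤ).map (Int.castRingHom ℚ)).conductorNorm ℤ)) (β : ℤ) (ι : K →+* ℂ) (ℓ : ℕ) (d : KolyvaginHeegnerData Dt β ι ℓ) (M : ℕ),
      ℓ.Prime ∧ Zhang2014.IsKolyvaginPrime (((⟨0, 0, 0, -7, 10⟩ : WeierstrassCurve ℤ).map (Int.castRingHom ℚ)).conductorNorm ℤ) ((⟨0, 0, 0, -7, 10⟩ : WeierstrassCurve ℤ).map (Int.castRingHom ℚ)) K 5 ℓ ∧
      1 ≤ M ∧ (M : ℕ∞) ≤ Zhang2014.levelIndex ((⟨0, 0, 0, -7, 10⟩ : WeierstrassCurve ℤ).map (Int.castRingHom ℚ)) 5 ℓ ∧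
      d.kolyvaginClass (p := 5) (by norm_num) M ≠ 0 := by
  haveI := isElliptic_c664a1
  haveI := isGloballyMinimal_c664a1
  haveI : NeZero (((⟨0, 0, 0, -7, 10⟩ : WeierstrassCurve ℤ).map (Int.castRingHom ℚ)).conductorNorm ℤ) := neZero_conductorNorm_of_isElliptic _
  intro hc' N _ f hf hkato D hD' hint htab
  have hC : c664a1.check = true :=
    (AtlasCurve.check_of_all atlasR2A00_check (by simp [atlasR2A00])).1
  have hH : SatisfiesHeegnerHypothesis (((⟨0, 0, 0, -7, 10⟩ : WeierstrassCurve ℤ).map (Int.castRingHom ℚ)).conductorNorm ℤ) K :=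
    satisfiesHeegnerHypothesis_conductorNorm_of_intModel intModel K hK.1 hD heegner_neg39
  have hc'' : (((⟨0, 0, 0, -7, 10⟩ : WeierstrassCurve ℤ).map (Int.castRingHom ℚ)).quadraticTwist (NumberField.discr K : ℚ)).selmerCorank 5 ≤ 1 := by
    rw [hD]; exact hc'
  obtain ⟨p', ap, n, A, tHi, tLo, H, L⟩ := c
  dsimp only at hc5
  subst hc5
  have hodd : Odd (NumberField.discr K) := by rw [hD]; decide
  have hps : SatisfiesHeegnerHypothesis 5 K := by
    rw [satisfiesHeegnerHypothesis_iff_kronecker 5 K hK.1, hD]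
    intro q hq hq5
    obtain rfl := (Nat.prime_dvd_prime_iff_eq hq (by norm_num : Nat.Prime 5)).mp hq5
    exact ⟨by norm_num, fun _ ↦ by norm_num⟩
  exact exists_kolyvaginPrime_class_ne_zero_at_of_atlasCell_split hA hF hPRS hC hc (hp := ⟨by norm_num⟩)
    ((⟨0, 0, 0, -7, 10⟩ : WeierstrassCurve ℤ).map (Int.castRingHom ℚ)) rfl hf hkato KernelCerts001.C664a1.row D hD' hint htab
    hasSurjectiveModNGaloisRep_5
    K hK (by rw [hD]; norm_num) (by rw [hD]; norm_num) (by rw [hD]; norm_num) hH hodd hps hc''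

end C664a1

namespace C681c1

/-- **ROW `681c1`, `(p, d_K) = (5, −83)` (g2's `depthRow_5_neg83_19`; `5` inert in `K`) — row-specific
λ-prediction via W. Zhang 2014 Thm. 1.1 (`hZ`; ♠ = `spade_5`).** For the cell `c ∈ c681c1.cells` with `c.p = 5` and any `K` with
`d_K = −83`: the twist datum `s_5(E^{(−83)}) ≤ 1`, `hF`, `hPRS`, the newform, Kato 17.4 and the symbol
DATA give a Kolyvagin PRIME `ℓ` for `(E, K, 5)`, `M ≤ M(ℓ)` and a datum with `c_M(ℓ) ≠ 0`, no non-zero class at depth `0`, `rank E^K < rank E`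
(side conditions kernel theorems). CONDITIONAL as stated; per-curve; BSD is not proved by it.
[cite: WZhang2014, Thm. 1.1 (p. 195)] [cite: Kolyvagin1991MathAnn, §2 Thm. 4] -/
theorem exists_kolyvaginPrime_class_ne_zero_of_lambda_at
    (hZ : WZhang2014_exists_kolyvaginClass_one_ne_zero)
    (hF : Kolyvagin1991_selmerCorank_of_kolyvaginClass_ne_zero) (hPRS : Schneider1985_order_charGenerator)
    (K : Type) [Field K] [NumberField K] (hK : IsImaginaryQuadratic K) (hD : NumberField.discr K = -83)
    {c : AtlasCell} (hc : c ∈ c681c1.cells) (hc5 : c.p = 5) :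
    haveI := isElliptic_c681c1;
    haveI := isGloballyMinimal_c681c1;
    haveI : NeZero (((⟨0, -1, 1, 0, 2⟩ : WeierstrassCurve ℤ).map (Int.castRingHom ℚ)).conductorNorm ℤ) := neZero_conductorNorm_of_isElliptic _;
    (((⟨0, -1, 1, 0, 2⟩ : WeierstrassCurve ℤ).map (Int.castRingHom ℚ)).quadraticTwist ((-83 : ℤ) : ℚ)).selmerCorank 5 ≤ 1 →
    ∀ {N : ℕ} [NeZero N] {f : CuspForm (Gamma0 N) 2}
    (_hf : IsNewformOf ((⟨0, -1, 1, 0, 2⟩ : WeierstrassCurve ℤ).map (Int.castRingHom ℚ)) f)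
    (_hkato : ∀ (κ : ZpExtension ℚ 5) (γ : Field.absoluteGaloisGroup ℚ),
      kato_divisibility ((⟨0, -1, 1, 0, 2⟩ : WeierstrassCurve ℤ).map (Int.castRingHom ℚ)) 5 (κ := κ) (γ := γ) (f := f))
    (D : ℚ) (_hD : ‖(D : ℚ_[5])‖ = 1) (_hint : ∀ x : ℚ, ‖(ratPlusSymbol f x : ℚ_[5])‖ ≤ 1)
    (_htab : ∀ u : ℕ, u < 5 ^ (c.n + 1) → ¬ 5 ∣ u →
      ratPlusSymbol f ((u : ℚ) / (5 : ℚ) ^ (c.n + 1)) = (c.tabHi.getD u 0 : ℚ) / D ∧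
      ratPlusSymbol f ((u : ℚ) / (5 : ℚ) ^ c.n) = (c.tabLo.getD (u % 5 ^ c.n) 0 : ℚ) / D),
    ∃ (Dt : ModularParametrizationData ((⟨0, -1, 1, 0, 2⟩ : WeierstrassCurve ℤ).map (Int.castRingHom ℚ))
        (((⟨0, -1, 1, 0, 2⟩ : WeierstrassCurve ℤ).map (Int.castRingHom ℚ)).conductorNorm ℤ)) (β : ℤ) (ι : K →+* ℂ) (ℓ : ℕ) (d : KolyvaginHeegnerData Dt β ι ℓ) (M : ℕ),
      ℓ.Prime ∧ Zhang2014.IsKolyvaginPrime (((⟨0, -1, 1, 0, 2⟩ : WeierstrassCurve ℤ).map (Int.castRingHom ℚ)).conductorNorm ℤ) ((⟨0, -1, 1, 0, 2⟩ : WeierstrassCurve ℤ).map (Int.castRingHom ℚ)) K 5 ℓ ∧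
      1 ≤ M ∧ (M : ℕ∞) ≤ Zhang2014.levelIndex ((⟨0, -1, 1, 0, 2⟩ : WeierstrassCurve ℤ).map (Int.castRingHom ℚ)) 5 ℓ ∧
      d.kolyvaginClass (p := 5) (by norm_num) M ≠ 0 ∧
      (∀ (n' : ℕ) (d' : KolyvaginHeegnerData Dt β ι n') (M' : ℕ),
        KolyvaginDescent.KolSupp (Zhang2014.IsKolyvaginPrime (((⟨0, -1, 1, 0, 2⟩ : WeierstrassCurve ℤ).map (Int.castRingHom ℚ)).conductorNorm ℤ) ((⟨0, -1, 1, 0, 2⟩ : WeierstrassCurve ℤ).map (Int.castRingHom ℚ)) K 5) n' →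
        1 ≤ M' → (M' : ℕ∞) ≤ Zhang2014.levelIndex ((⟨0, -1, 1, 0, 2⟩ : WeierstrassCurve ℤ).map (Int.castRingHom ℚ)) 5 n' →
        d'.kolyvaginClass (p := 5) (by norm_num) M' ≠ 0 → 1 ≤ n'.primeFactors.card) ∧
      (((⟨0, -1, 1, 0, 2⟩ : WeierstrassCurve ℤ).map (Int.castRingHom ℚ)).quadraticTwist (NumberField.discr K : ℚ)).mordellWeilRank < ((⟨0, -1, 1, 0, 2⟩ : WeierstrassCurve ℤ).map (Int.castRingHom ℚ)).mordellWeilRank := by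
  haveI := isElliptic_c681c1
  haveI := isGloballyMinimal_c681c1
  haveI : NeZero (((⟨0, -1, 1, 0, 2⟩ : WeierstrassCurve ℤ).map (Int.castRingHom ℚ)).conductorNorm ℤ) := neZero_conductorNorm_of_isElliptic _
  intro hc' N _ f hf hkato D hD' hint htab
  have hC : c681c1.check = true :=
    (AtlasCurve.check_of_all atlasR2A00_check (by simp [atlasR2A00])).1
  have hH : SatisfiesHeegnerHypothesis (((⟨0, -1, 1, 0, 2⟩ : WeierstrassCurve ℤ).map (Int.castRingHom ℚ)).conductorNorm ℤ) K :=
    satisfiesHeegnerHypothesis_conductorNorm_of_intModel intModel K hK.1 hD heegner_neg83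
  have hc'' : (((⟨0, -1, 1, 0, 2⟩ : WeierstrassCurve ℤ).map (Int.castRingHom ℚ)).quadraticTwist (NumberField.discr K : ℚ)).selmerCorank 5 ≤ 1 := by
    rw [hD]; exact hc'
  obtain ⟨p', ap, n, A, tHi, tLo, H, L⟩ := c
  dsimp only at hc5
  subst hc5
  exact exists_kolyvaginPrime_class_ne_zero_at_of_atlasCell hZ hF hPRS hC hc (hp := ⟨by norm_num⟩)
    ((⟨0, -1, 1, 0, 2⟩ : WeierstrassCurve ℤ).map (Int.castRingHom ℚ)) rfl hf hkato KernelCerts002.C681c1.row D hD' hint htab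
    hasSurjectiveModNGaloisRep_5
    spade_5.1 (fun h ↦ absurd spade_5.2 h) K hK (by rw [hD]; norm_num) (by rw [hD]; norm_num)
    (by rw [hD]; norm_num) hH hc''

end C681c1

namespace C707a1

/-- **ROW `707a1`, `(p, d_K) = (5, −19)` (g2's `depthRow_5_neg19_179`; `5` split in `K`) — row-specific
λ-prediction via W. Zhang 2014 Thm. 1.1 (`hZ`; ♠ = `spade_5`).** For the cell `c ∈ c707a1.cells` with `c.p = 5` and any `K` with
`d_K = −19`: the twist datum `s_5(E^{(−19)}) ≤ 1`, `hF`, `hPRS`, the newform, Kato 17.4 and the symbol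
DATA give a Kolyvagin PRIME `ℓ` for `(E, K, 5)`, `M ≤ M(ℓ)` and a datum with `c_M(ℓ) ≠ 0`, no non-zero class at depth `0`, `rank E^K < rank E`
(side conditions kernel theorems). CONDITIONAL as stated; per-curve; BSD is not proved by it.
[cite: WZhang2014, Thm. 1.1 (p. 195)] [cite: Kolyvagin1991MathAnn, §2 Thm. 4] -/
theorem exists_kolyvaginPrime_class_ne_zero_of_lambda_at
    (hZ : WZhang2014_exists_kolyvaginClass_one_ne_zero)
    (hF : Kolyvagin1991_selmerCorank_of_kolyvaginClass_ne_zero) (hPRS : Schneider1985_order_charGenerator)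
    (K : Type) [Field K] [NumberField K] (hK : IsImaginaryQuadratic K) (hD : NumberField.discr K = -19)
    {c : AtlasCell} (hc : c ∈ c707a1.cells) (hc5 : c.p = 5) :
    haveI := isElliptic_c707a1;
    haveI := isGloballyMinimal_c707a1;
    haveI : NeZero (((⟨0, 1, 1, -12, 12⟩ : WeierstrassCurve ℤ).map (Int.castRingHom ℚ)).conductorNorm ℤ) := neZero_conductorNorm_of_isElliptic _;
    (((⟨0, 1, 1, -12, 12⟩ : WeierstrassCurve ℤ).map (Int.castRingHom ℚ)).quadraticTwist ((-19 : ℤ) : ℚ)).selmerCorank 5 ≤ 1 →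
    ∀ {N : ℕ} [NeZero N] {f : CuspForm (Gamma0 N) 2}
    (_hf : IsNewformOf ((⟨0, 1, 1, -12, 12⟩ : WeierstrassCurve ℤ).map (Int.castRingHom ℚ)) f)
    (_hkato : ∀ (κ : ZpExtension ℚ 5) (γ : Field.absoluteGaloisGroup ℚ),
      kato_divisibility ((⟨0, 1, 1, -12, 12⟩ : WeierstrassCurve ℤ).map (Int.castRingHom ℚ)) 5 (κ := κ) (γ := γ) (f := f))
    (D : ℚ) (_hD : ‖(D : ℚ_[5])‖ = 1) (_hint : ∀ x : ℚ, ‖(ratPlusSymbol f x : ℚ_[5])‖ ≤ 1)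
    (_htab : ∀ u : ℕ, u < 5 ^ (c.n + 1) → ¬ 5 ∣ u →
      ratPlusSymbol f ((u : ℚ) / (5 : ℚ) ^ (c.n + 1)) = (c.tabHi.getD u 0 : ℚ) / D ∧
      ratPlusSymbol f ((u : ℚ) / (5 : ℚ) ^ c.n) = (c.tabLo.getD (u % 5 ^ c.n) 0 : ℚ) / D),
    ∃ (Dt : ModularParametrizationData ((⟨0, 1, 1, -12, 12⟩ : WeierstrassCurve ℤ).map (Int.castRingHom ℚ))
        (((⟨0, 1, 1, -12, 12⟩ : WeierstrassCurve ℤ).map (Int.castRingHom ℚ)).conductorNorm ℤ)) (β : ℤ) (ι : K →+* ℂ) (ℓ : ℕ) (d : KolyvaginHeegnerData Dt β ι ℓ) (M : ℕ),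
      ℓ.Prime ∧ Zhang2014.IsKolyvaginPrime (((⟨0, 1, 1, -12, 12⟩ : WeierstrassCurve ℤ).map (Int.castRingHom ℚ)).conductorNorm ℤ) ((⟨0, 1, 1, -12, 12⟩ : WeierstrassCurve ℤ).map (Int.castRingHom ℚ)) K 5 ℓ ∧
      1 ≤ M ∧ (M : ℕ∞) ≤ Zhang2014.levelIndex ((⟨0, 1, 1, -12, 12⟩ : WeierstrassCurve ℤ).map (Int.castRingHom ℚ)) 5 ℓ ∧
      d.kolyvaginClass (p := 5) (by norm_num) M ≠ 0 ∧
      (∀ (n' : ℕ) (d' : KolyvaginHeegnerData Dt β ι n') (M' : ℕ),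
        KolyvaginDescent.KolSupp (Zhang2014.IsKolyvaginPrime (((⟨0, 1, 1, -12, 12⟩ : WeierstrassCurve ℤ).map (Int.castRingHom ℚ)).conductorNorm ℤ) ((⟨0, 1, 1, -12, 12⟩ : WeierstrassCurve ℤ).map (Int.castRingHom ℚ)) K 5) n' →
        1 ≤ M' → (M' : ℕ∞) ≤ Zhang2014.levelIndex ((⟨0, 1, 1, -12, 12⟩ : WeierstrassCurve ℤ).map (Int.castRingHom ℚ)) 5 n' →
        d'.kolyvaginClass (p := 5) (by norm_num) M' ≠ 0 → 1 ≤ n'.primeFactors.card) ∧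
      (((⟨0, 1, 1, -12, 12⟩ : WeierstrassCurve ℤ).map (Int.castRingHom ℚ)).quadraticTwist (NumberField.discr K : ℚ)).mordellWeilRank < ((⟨0, 1, 1, -12, 12⟩ : WeierstrassCurve ℤ).map (Int.castRingHom ℚ)).mordellWeilRank := by
  haveI := isElliptic_c707a1
  haveI := isGloballyMinimal_c707a1
  haveI : NeZero (((⟨0, 1, 1, -12, 12⟩ : WeierstrassCurve ℤ).map (Int.castRingHom ℚ)).conductorNorm ℤ) := neZero_conductorNorm_of_isElliptic _
  intro hc' N _ f hf hkato D hD' hint htab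
  have hC : c707a1.check = true :=
    (AtlasCurve.check_of_all atlasR2A00_check (by simp [atlasR2A00])).1
  have hH : SatisfiesHeegnerHypothesis (((⟨0, 1, 1, -12, 12⟩ : WeierstrassCurve ℤ).map (Int.castRingHom ℚ)).conductorNorm ℤ) K :=
    satisfiesHeegnerHypothesis_conductorNorm_of_intModel intModel K hK.1 hD heegner_neg19
  have hc'' : (((⟨0, 1, 1, -12, 12⟩ : WeierstrassCurve ℤ).map (Int.castRingHom ℚ)).quadraticTwist (NumberField.discr K : ℚ)).selmerCorank 5 ≤ 1 := by
    rw [hD]; exact hc'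
  obtain ⟨p', ap, n, A, tHi, tLo, H, L⟩ := c
  dsimp only at hc5
  subst hc5
  exact exists_kolyvaginPrime_class_ne_zero_at_of_atlasCell hZ hF hPRS hC hc (hp := ⟨by norm_num⟩)
    ((⟨0, 1, 1, -12, 12⟩ : WeierstrassCurve ℤ).map (Int.castRingHom ℚ)) rfl hf hkato KernelCerts002.C707a1.row D hD' hint htab
    hasSurjectiveModNGaloisRep_5
    spade_5.1 (fun h ↦ absurd spade_5.2 h) K hK (by rw [hD]; norm_num) (by rw [hD]; norm_num)
    (by rw [hD]; norm_num) hH hc''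

end C707a1

namespace C709a1

/-- **ROW `709a1`, `(p, d_K) = (5, −7)` (g2's `depthRow_5_neg7_409`; `5` inert in `K`) — row-specific
λ-prediction via W. Zhang 2014 Thm. 1.1 (`hZ`; ♠ = `spade_5`).** For the cell `c ∈ c709a1.cells` with `c.p = 5` and any `K` with
`d_K = −7`: the twist datum `s_5(E^{(−7)}) ≤ 1`, `hF`, `hPRS`, the newform, Kato 17.4 and the symbol
DATA give a Kolyvagin PRIME `ℓ` for `(E, K, 5)`, `M ≤ M(ℓ)` and a datum with `c_M(ℓ) ≠ 0`, no non-zero class at depth `0`, `rank E^K < rank E`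
(side conditions kernel theorems). CONDITIONAL as stated; per-curve; BSD is not proved by it.
[cite: WZhang2014, Thm. 1.1 (p. 195)] [cite: Kolyvagin1991MathAnn, §2 Thm. 4] -/
theorem exists_kolyvaginPrime_class_ne_zero_of_lambda_at
    (hZ : WZhang2014_exists_kolyvaginClass_one_ne_zero)
    (hF : Kolyvagin1991_selmerCorank_of_kolyvaginClass_ne_zero) (hPRS : Schneider1985_order_charGenerator)
    (K : Type) [Field K] [NumberField K] (hK : IsImaginaryQuadratic K) (hD : NumberField.discr K = -7)
    {c : AtlasCell} (hc : c ∈ c709a1.cells) (hc5 : c.p = 5) :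
    haveI := isElliptic_c709a1;
    haveI := isGloballyMinimal_c709a1;
    haveI : NeZero (((⟨0, -1, 1, -2, 0⟩ : WeierstrassCurve ℤ).map (Int.castRingHom ℚ)).conductorNorm ℤ) := neZero_conductorNorm_of_isElliptic _;
    (((⟨0, -1, 1, -2, 0⟩ : WeierstrassCurve ℤ).map (Int.castRingHom ℚ)).quadraticTwist ((-7 : ℤ) : ℚ)).selmerCorank 5 ≤ 1 →
    ∀ {N : ℕ} [NeZero N] {f : CuspForm (Gamma0 N) 2}
    (_hf : IsNewformOf ((⟨0, -1, 1, -2, 0⟩ : WeierstrassCurve ℤ).map (Int.castRingHom ℚ)) f)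
    (_hkato : ∀ (κ : ZpExtension ℚ 5) (γ : Field.absoluteGaloisGroup ℚ),
      kato_divisibility ((⟨0, -1, 1, -2, 0⟩ : WeierstrassCurve ℤ).map (Int.castRingHom ℚ)) 5 (κ := κ) (γ := γ) (f := f))
    (D : ℚ) (_hD : ‖(D : ℚ_[5])‖ = 1) (_hint : ∀ x : ℚ, ‖(ratPlusSymbol f x : ℚ_[5])‖ ≤ 1)
    (_htab : ∀ u : ℕ, u < 5 ^ (c.n + 1) → ¬ 5 ∣ u →
      ratPlusSymbol f ((u : ℚ) / (5 : ℚ) ^ (c.n + 1)) = (c.tabHi.getD u 0 : ℚ) / D ∧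
      ratPlusSymbol f ((u : ℚ) / (5 : ℚ) ^ c.n) = (c.tabLo.getD (u % 5 ^ c.n) 0 : ℚ) / D),
    ∃ (Dt : ModularParametrizationData ((⟨0, -1, 1, -2, 0⟩ : WeierstrassCurve ℤ).map (Int.castRingHom ℚ))
        (((⟨0, -1, 1, -2, 0⟩ : WeierstrassCurve ℤ).map (Int.castRingHom ℚ)).conductorNorm ℤ)) (β : ℤ) (ι : K →+* ℂ) (ℓ : ℕ) (d : KolyvaginHeegnerData Dt β ι ℓ) (M : ℕ),
      ℓ.Prime ∧ Zhang2014.IsKolyvaginPrime (((⟨0, -1, 1, -2, 0⟩ : WeierstrassCurve ℤ).map (Int.castRingHom ℚ)).conductorNorm ℤ) ((⟨0, -1, 1, -2, 0⟩ : WeierstrassCurve ℤ).map (Int.castRingHom ℚ)) K 5 ℓ ∧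
      1 ≤ M ∧ (M : ℕ∞) ≤ Zhang2014.levelIndex ((⟨0, -1, 1, -2, 0⟩ : WeierstrassCurve ℤ).map (Int.castRingHom ℚ)) 5 ℓ ∧
      d.kolyvaginClass (p := 5) (by norm_num) M ≠ 0 ∧
      (∀ (n' : ℕ) (d' : KolyvaginHeegnerData Dt β ι n') (M' : ℕ),
        KolyvaginDescent.KolSupp (Zhang2014.IsKolyvaginPrime (((⟨0, -1, 1, -2, 0⟩ : WeierstrassCurve ℤ).map (Int.castRingHom ℚ)).conductorNorm ℤ) ((⟨0, -1, 1, -2, 0⟩ : WeierstrassCurve ℤ).map (Int.castRingHom ℚ)) K 5) n' →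
        1 ≤ M' → (M' : ℕ∞) ≤ Zhang2014.levelIndex ((⟨0, -1, 1, -2, 0⟩ : WeierstrassCurve ℤ).map (Int.castRingHom ℚ)) 5 n' →
        d'.kolyvaginClass (p := 5) (by norm_num) M' ≠ 0 → 1 ≤ n'.primeFactors.card) ∧
      (((⟨0, -1, 1, -2, 0⟩ : WeierstrassCurve ℤ).map (Int.castRingHom ℚ)).quadraticTwist (NumberField.discr K : ℚ)).mordellWeilRank < ((⟨0, -1, 1, -2, 0⟩ : WeierstrassCurve ℤ).map (Int.castRingHom ℚ)).mordellWeilRank := by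
  haveI := isElliptic_c709a1
  haveI := isGloballyMinimal_c709a1
  haveI : NeZero (((⟨0, -1, 1, -2, 0⟩ : WeierstrassCurve ℤ).map (Int.castRingHom ℚ)).conductorNorm ℤ) := neZero_conductorNorm_of_isElliptic _
  intro hc' N _ f hf hkato D hD' hint htab
  have hC : c709a1.check = true :=
    (AtlasCurve.check_of_all atlasR2A00_check (by simp [atlasR2A00])).1
  have hH : SatisfiesHeegnerHypothesis (((⟨0, -1, 1, -2, 0⟩ : WeierstrassCurve ℤ).map (Int.castRingHom ℚ)).conductorNorm ℤ) K :=
    satisfiesHeegnerHypothesis_conductorNorm_of_intModel intModel K hK.1 hD heegner_neg7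
  have hc'' : (((⟨0, -1, 1, -2, 0⟩ : WeierstrassCurve ℤ).map (Int.castRingHom ℚ)).quadraticTwist (NumberField.discr K : ℚ)).selmerCorank 5 ≤ 1 := by
    rw [hD]; exact hc'
  obtain ⟨p', ap, n, A, tHi, tLo, H, L⟩ := c
  dsimp only at hc5
  subst hc5
  exact exists_kolyvaginPrime_class_ne_zero_at_of_atlasCell hZ hF hPRS hC hc (hp := ⟨by norm_num⟩)
    ((⟨0, -1, 1, -2, 0⟩ : WeierstrassCurve ℤ).map (Int.castRingHom ℚ)) rfl hf hkato KernelCerts002.C709a1.row D hD' hint htab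
    hasSurjectiveModNGaloisRep_5
    spade_5.1 (fun h ↦ absurd spade_5.2 h) K hK (by rw [hD]; norm_num) (by rw [hD]; norm_num)
    (by rw [hD]; norm_num) hH hc''

end C709a1

namespace C718b1

/-- **ROW `718b1`, `(p, d_K) = (5, −7)` (g2's `depthRow_5_neg7_59`; `5` inert in `K`) — row-specific
λ-prediction via W. Zhang 2014 Thm. 1.1 (`hZ`; ♠ = `spade_5`).** For the cell `c ∈ c718b1.cells` with `c.p = 5` and any `K` with
`d_K = −7`: the twist datum `s_5(E^{(−7)}) ≤ 1`, `hF`, `hPRS`, the newform, Kato 17.4 and the symbol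
DATA give a Kolyvagin PRIME `ℓ` for `(E, K, 5)`, `M ≤ M(ℓ)` and a datum with `c_M(ℓ) ≠ 0`, no non-zero class at depth `0`, `rank E^K < rank E`
(side conditions kernel theorems). CONDITIONAL as stated; per-curve; BSD is not proved by it.
[cite: WZhang2014, Thm. 1.1 (p. 195)] [cite: Kolyvagin1991MathAnn, §2 Thm. 4] -/
theorem exists_kolyvaginPrime_class_ne_zero_of_lambda_at
    (hZ : WZhang2014_exists_kolyvaginClass_one_ne_zero)
    (hF : Kolyvagin1991_selmerCorank_of_kolyvaginClass_ne_zero) (hPRS : Schneider1985_order_charGenerator)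
    (K : Type) [Field K] [NumberField K] (hK : IsImaginaryQuadratic K) (hD : NumberField.discr K = -7)
    {c : AtlasCell} (hc : c ∈ c718b1.cells) (hc5 : c.p = 5) :
    haveI := isElliptic_c718b1;
    haveI := isGloballyMinimal_c718b1;
    haveI : NeZero (((⟨1, 0, 1, -5, 0⟩ : WeierstrassCurve ℤ).map (Int.castRingHom ℚ)).conductorNorm ℤ) := neZero_conductorNorm_of_isElliptic _;
    (((⟨1, 0, 1, -5, 0⟩ : WeierstrassCurve ℤ).map (Int.castRingHom ℚ)).quadraticTwist ((-7 : ℤ) : ℚ)).selmerCorank 5 ≤ 1 →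
    ∀ {N : ℕ} [NeZero N] {f : CuspForm (Gamma0 N) 2}
    (_hf : IsNewformOf ((⟨1, 0, 1, -5, 0⟩ : WeierstrassCurve ℤ).map (Int.castRingHom ℚ)) f)
    (_hkato : ∀ (κ : ZpExtension ℚ 5) (γ : Field.absoluteGaloisGroup ℚ),
      kato_divisibility ((⟨1, 0, 1, -5, 0⟩ : WeierstrassCurve ℤ).map (Int.castRingHom ℚ)) 5 (κ := κ) (γ := γ) (f := f))
    (D : ℚ) (_hD : ‖(D : ℚ_[5])‖ = 1) (_hint : ∀ x : ℚ, ‖(ratPlusSymbol f x : ℚ_[5])‖ ≤ 1)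
    (_htab : ∀ u : ℕ, u < 5 ^ (c.n + 1) → ¬ 5 ∣ u →
      ratPlusSymbol f ((u : ℚ) / (5 : ℚ) ^ (c.n + 1)) = (c.tabHi.getD u 0 : ℚ) / D ∧
      ratPlusSymbol f ((u : ℚ) / (5 : ℚ) ^ c.n) = (c.tabLo.getD (u % 5 ^ c.n) 0 : ℚ) / D),
    ∃ (Dt : ModularParametrizationData ((⟨1, 0, 1, -5, 0⟩ : WeierstrassCurve ℤ).map (Int.castRingHom ℚ))
        (((⟨1, 0, 1, -5, 0⟩ : WeierstrassCurve ℤ).map (Int.castRingHom ℚ)).conductorNorm ℤ)) (β : ℤ) (ι : K →+* ℂ) (ℓ : ℕ) (d : KolyvaginHeegnerData Dt β ι ℓ) (M : ℕ),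
      ℓ.Prime ∧ Zhang2014.IsKolyvaginPrime (((⟨1, 0, 1, -5, 0⟩ : WeierstrassCurve ℤ).map (Int.castRingHom ℚ)).conductorNorm ℤ) ((⟨1, 0, 1, -5, 0⟩ : WeierstrassCurve ℤ).map (Int.castRingHom ℚ)) K 5 ℓ ∧
      1 ≤ M ∧ (M : ℕ∞) ≤ Zhang2014.levelIndex ((⟨1, 0, 1, -5, 0⟩ : WeierstrassCurve ℤ).map (Int.castRingHom ℚ)) 5 ℓ ∧
      d.kolyvaginClass (p := 5) (by norm_num) M ≠ 0 ∧
      (∀ (n' : ℕ) (d' : KolyvaginHeegnerData Dt β ι n') (M' : ℕ),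
        KolyvaginDescent.KolSupp (Zhang2014.IsKolyvaginPrime (((⟨1, 0, 1, -5, 0⟩ : WeierstrassCurve ℤ).map (Int.castRingHom ℚ)).conductorNorm ℤ) ((⟨1, 0, 1, -5, 0⟩ : WeierstrassCurve ℤ).map (Int.castRingHom ℚ)) K 5) n' →
        1 ≤ M' → (M' : ℕ∞) ≤ Zhang2014.levelIndex ((⟨1, 0, 1, -5, 0⟩ : WeierstrassCurve ℤ).map (Int.castRingHom ℚ)) 5 n' →
        d'.kolyvaginClass (p := 5) (by norm_num) M' ≠ 0 → 1 ≤ n'.primeFactors.card) ∧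
      (((⟨1, 0, 1, -5, 0⟩ : WeierstrassCurve ℤ).map (Int.castRingHom ℚ)).quadraticTwist (NumberField.discr K : ℚ)).mordellWeilRank < ((⟨1, 0, 1, -5, 0⟩ : WeierstrassCurve ℤ).map (Int.castRingHom ℚ)).mordellWeilRank := by
  haveI := isElliptic_c718b1
  haveI := isGloballyMinimal_c718b1
  haveI : NeZero (((⟨1, 0, 1, -5, 0⟩ : WeierstrassCurve ℤ).map (Int.castRingHom ℚ)).conductorNorm ℤ) := neZero_conductorNorm_of_isElliptic _
  intro hc' N _ f hf hkato D hD' hint htab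
  have hC : c718b1.check = true :=
    (AtlasCurve.check_of_all atlasR2A00_check (by simp [atlasR2A00])).1
  have hH : SatisfiesHeegnerHypothesis (((⟨1, 0, 1, -5, 0⟩ : WeierstrassCurve ℤ).map (Int.castRingHom ℚ)).conductorNorm ℤ) K :=
    satisfiesHeegnerHypothesis_conductorNorm_of_intModel intModel K hK.1 hD heegner_neg7
  have hc'' : (((⟨1, 0, 1, -5, 0⟩ : WeierstrassCurve ℤ).map (Int.castRingHom ℚ)).quadraticTwist (NumberField.discr K : ℚ)).selmerCorank 5 ≤ 1 := by
    rw [hD]; exact hc'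
  obtain ⟨p', ap, n, A, tHi, tLo, H, L⟩ := c
  dsimp only at hc5
  subst hc5
  exact exists_kolyvaginPrime_class_ne_zero_at_of_atlasCell hZ hF hPRS hC hc (hp := ⟨by norm_num⟩)
    ((⟨1, 0, 1, -5, 0⟩ : WeierstrassCurve ℤ).map (Int.castRingHom ℚ)) rfl hf hkato KernelCerts002.C718b1.row D hD' hint htab
    hasSurjectiveModNGaloisRep_5
    spade_5.1 (fun h ↦ absurd spade_5.2 h) K hK (by rw [hD]; norm_num) (by rw [hD]; norm_num)
    (by rw [hD]; norm_num) hH hc''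

end C718b1

namespace C794a1

/-- **ROW `794a1`, `(p, d_K) = (5, −23)` (g2's `depthRow_5_neg23_89`; `5` inert in `K`) — row-specific
λ-prediction via W. Zhang 2014 Thm. 1.1 (`hZ`; ♠ = `spade_5`).** For the cell `c ∈ c794a1.cells` with `c.p = 5` and any `K` with
`d_K = −23`: the twist datum `s_5(E^{(−23)}) ≤ 1`, `hF`, `hPRS`, the newform, Kato 17.4 and the symbol
DATA give a Kolyvagin PRIME `ℓ` for `(E, K, 5)`, `M ≤ M(ℓ)` and a datum with `c_M(ℓ) ≠ 0`, no non-zero class at depth `0`, `rank E^K < rank E`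
(side conditions kernel theorems). CONDITIONAL as stated; per-curve; BSD is not proved by it.
[cite: WZhang2014, Thm. 1.1 (p. 195)] [cite: Kolyvagin1991MathAnn, §2 Thm. 4] -/
theorem exists_kolyvaginPrime_class_ne_zero_of_lambda_at
    (hZ : WZhang2014_exists_kolyvaginClass_one_ne_zero)
    (hF : Kolyvagin1991_selmerCorank_of_kolyvaginClass_ne_zero) (hPRS : Schneider1985_order_charGenerator)
    (K : Type) [Field K] [NumberField K] (hK : IsImaginaryQuadratic K) (hD : NumberField.discr K = -23)
    {c : AtlasCell} (hc : c ∈ c794a1.cells) (hc5 : c.p = 5) :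
    haveI := isElliptic_c794a1;
    haveI := isGloballyMinimal_c794a1;
    haveI : NeZero (((⟨1, 0, 1, -3, 2⟩ : WeierstrassCurve ℤ).map (Int.castRingHom ℚ)).conductorNorm ℤ) := neZero_conductorNorm_of_isElliptic _;
    (((⟨1, 0, 1, -3, 2⟩ : WeierstrassCurve ℤ).map (Int.castRingHom ℚ)).quadraticTwist ((-23 : ℤ) : ℚ)).selmerCorank 5 ≤ 1 →
    ∀ {N : ℕ} [NeZero N] {f : CuspForm (Gamma0 N) 2}
    (_hf : IsNewformOf ((⟨1, 0, 1, -3, 2⟩ : WeierstrassCurve ℤ).map (Int.castRingHom ℚ)) f)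
    (_hkato : ∀ (κ : ZpExtension ℚ 5) (γ : Field.absoluteGaloisGroup ℚ),
      kato_divisibility ((⟨1, 0, 1, -3, 2⟩ : WeierstrassCurve ℤ).map (Int.castRingHom ℚ)) 5 (κ := κ) (γ := γ) (f := f))
    (D : ℚ) (_hD : ‖(D : ℚ_[5])‖ = 1) (_hint : ∀ x : ℚ, ‖(ratPlusSymbol f x : ℚ_[5])‖ ≤ 1)
    (_htab : ∀ u : ℕ, u < 5 ^ (c.n + 1) → ¬ 5 ∣ u →
      ratPlusSymbol f ((u : ℚ) / (5 : ℚ) ^ (c.n + 1)) = (c.tabHi.getD u 0 : ℚ) / D ∧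
      ratPlusSymbol f ((u : ℚ) / (5 : ℚ) ^ c.n) = (c.tabLo.getD (u % 5 ^ c.n) 0 : ℚ) / D),
    ∃ (Dt : ModularParametrizationData ((⟨1, 0, 1, -3, 2⟩ : WeierstrassCurve ℤ).map (Int.castRingHom ℚ))
        (((⟨1, 0, 1, -3, 2⟩ : WeierstrassCurve ℤ).map (Int.castRingHom ℚ)).conductorNorm ℤ)) (β : ℤ) (ι : K →+* ℂ) (ℓ : ℕ) (d : KolyvaginHeegnerData Dt β ι ℓ) (M : ℕ),
      ℓ.Prime ∧ Zhang2014.IsKolyvaginPrime (((⟨1, 0, 1, -3, 2⟩ : WeierstrassCurve ℤ).map (Int.castRingHom ℚ)).conductorNorm ℤ) ((⟨1, 0, 1, -3, 2⟩ : WeierstrassCurve ℤ).map (Int.castRingHom ℚ)) K 5 ℓ ∧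
      1 ≤ M ∧ (M : ℕ∞) ≤ Zhang2014.levelIndex ((⟨1, 0, 1, -3, 2⟩ : WeierstrassCurve ℤ).map (Int.castRingHom ℚ)) 5 ℓ ∧
      d.kolyvaginClass (p := 5) (by norm_num) M ≠ 0 ∧
      (∀ (n' : ℕ) (d' : KolyvaginHeegnerData Dt β ι n') (M' : ℕ),
        KolyvaginDescent.KolSupp (Zhang2014.IsKolyvaginPrime (((⟨1, 0, 1, -3, 2⟩ : WeierstrassCurve ℤ).map (Int.castRingHom ℚ)).conductorNorm ℤ) ((⟨1, 0, 1, -3, 2⟩ : WeierstrassCurve ℤ).map (Int.castRingHom ℚ)) K 5) n' →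
        1 ≤ M' → (M' : ℕ∞) ≤ Zhang2014.levelIndex ((⟨1, 0, 1, -3, 2⟩ : WeierstrassCurve ℤ).map (Int.castRingHom ℚ)) 5 n' →
        d'.kolyvaginClass (p := 5) (by norm_num) M' ≠ 0 → 1 ≤ n'.primeFactors.card) ∧
      (((⟨1, 0, 1, -3, 2⟩ : WeierstrassCurve ℤ).map (Int.castRingHom ℚ)).quadraticTwist (NumberField.discr K : ℚ)).mordellWeilRank < ((⟨1, 0, 1, -3, 2⟩ : WeierstrassCurve ℤ).map (Int.castRingHom ℚ)).mordellWeilRank := by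
  haveI := isElliptic_c794a1
  haveI := isGloballyMinimal_c794a1
  haveI : NeZero (((⟨1, 0, 1, -3, 2⟩ : WeierstrassCurve ℤ).map (Int.castRingHom ℚ)).conductorNorm ℤ) := neZero_conductorNorm_of_isElliptic _
  intro hc' N _ f hf hkato D hD' hint htab
  have hC : c794a1.check = true :=
    (AtlasCurve.check_of_all atlasR2A00_check (by simp [atlasR2A00])).1
  have hH : SatisfiesHeegnerHypothesis (((⟨1, 0, 1, -3, 2⟩ : WeierstrassCurve ℤ).map (Int.castRingHom ℚ)).conductorNorm ℤ) K :=
    satisfiesHeegnerHypothesis_conductorNorm_of_intModel intModel K hK.1 hD heegner_neg23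
  have hc'' : (((⟨1, 0, 1, -3, 2⟩ : WeierstrassCurve ℤ).map (Int.castRingHom ℚ)).quadraticTwist (NumberField.discr K : ℚ)).selmerCorank 5 ≤ 1 := by
    rw [hD]; exact hc'
  obtain ⟨p', ap, n, A, tHi, tLo, H, L⟩ := c
  dsimp only at hc5
  subst hc5
  exact exists_kolyvaginPrime_class_ne_zero_at_of_atlasCell hZ hF hPRS hC hc (hp := ⟨by norm_num⟩)
    ((⟨1, 0, 1, -3, 2⟩ : WeierstrassCurve ℤ).map (Int.castRingHom ℚ)) rfl hf hkato KernelCerts002.C794a1.row D hD' hint htab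
    hasSurjectiveModNGaloisRep_5
    spade_5.1 (fun h ↦ absurd spade_5.2 h) K hK (by rw [hD]; norm_num) (by rw [hD]; norm_num)
    (by rw [hD]; norm_num) hH hc''

end C794a1

end Summit.BirchSwinnertonDyer.BirchSwinnertonDyer.Theorems.KolyvaginDepthDoor

end
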